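/-
Copyright (c) 2026 the pub-hodgecm-mathlib formalisation cell (harness21).  Prover seat hodgecm-mathlib-LH4-p07 (g4), req620 Track A «(D-RAM) FOUR-FRAME» squad
(heir LEAD F0P3a-plan lineage; dealer LH4-plan lineage WORD #26 (1); MS ROAD A, Stage B₂ brick B7₂ (iv)₂ «CORE-HANGING STRATA, TYPE 2 — THE WEIGHTED COUNT», FILE (D1₂):
stability in `κ`-currency on the foot and the EMPTY regimes; Stage B lead LH4-p10 (g2)).  2026-09-04.
-/
import Summits.HodgeConjecture.HodgeConjecture.Theorems.F0P3cDyRamDiagonalCoreHangingFoot             -- ★ p856147 (this seat's g3, B7 (iv) (D1)): the type-0 template, `v_one_sub_glueUnit`; brings ★ `…CoreHangingOrbits` (`v_one_add_kappa_eq_one`), ★ B1, ★ `v_varpi_pow`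
import Summits.HodgeConjecture.HodgeConjecture.Theorems.F0P3cDyRamDiagonalGluedStabilityCorner         -- ★ (F0P3-p01): `mapGL_latt_hnf_glued_corner_eq_iff`, `depths_of_mapGL_latt_hnf_glued_typeTwo_eq`
import Summits.HodgeConjecture.HodgeConjecture.Theorems.F0P3cDyRamDiagonalStrataDefs                    -- ★ ED. 3: `IsTypeTwoPolarisable`
import HarnessLib

/-!
# Crux `H413`, MS ROAD A, STAGE B₂ brick B7₂ (iv)₂, FILE (D1₂): the CORE-HANGING TYPE-2 stratum `H(2ρ+1)` OFF THE TUBE — stability in `κ`-currency on the foot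
# `n₁ = n₂ = m`, and the three EMPTY regimes

Cell `hodgecm-mathlib` (D-0151), FLOOR 0, crux item H413 = `stmt-HodgeConjecture-24833`; lane `--supports stmt-HodgeConjecture-24833 --as helper` (count-neutral).  THEOREMS ONLY
(no `def`, no instance, no notation, no `sorry`, default heartbeats).  The type-2 twin of ★ p856147 `F0P3cDyRamDiagonalCoreHangingFoot` §2–§3 (corner `2ρ+1` instead of `2ρ`;
the glue-class arithmetic §1 of that file is frame-free and is reused verbatim by FILE (D2₂)).
THE MATHEMATICS (LH4-p10 (g2) skeleton₂ `stub_B7_H`; ★ `mapGL_latt_hnf_glued_corner_eq_iff` at `s = 0`, `e = 1`).  For `T = diag(α, β, 1)` on the foot `|β−1| = |α−1| = |ϖ|^m`,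
`|β−α| = |ϖ|^{n₃}`, the three stability congruences of `latt V_H₂(x,ζ,y″)`, `V_H₂ = (1 0 0; x ϖ^ρ 0; xζ+y″ ϖ^ρζ ϖ^{2ρ+1})`, read `ρ ≤ n₃`, `ρ + 1 ≤ m`, and the GLUE congruence
`|(β−1)xζ + (α−1)y″| ≤ |ϖ|^{2ρ+1}`, i.e. `|κ + g₀| ≤ |ϖ|^{2ρ+1−m}` with `κ = y″∕(xζ)` and the GLUE UNIT `g₀ = (β−1)∕(α−1)` (vacuous when `2ρ+1 ≤ m`: the tube).  Hence the
stratum `𝒮_H₂(ρ) = {M ∈ 𝓛₀(T) ∣ type-2 polarisable ∧ M = latt V_H₂(x,ζ,y″), x ζ y″ xζ+y″ units}` is EMPTY (a) off the foot below the tube (`n₁ ≠ n₂`, ★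
`depths_of_mapGL_latt_hnf_glued_typeTwo_eq`), (b) on the foot with `m < ρ + 1`, (c) on the foot below the tube (`m < 2ρ+1`) off the equilateral case `n₃ = m` — because then
`|1 − g₀| < 1` (`|1 − g₀|·|ϖ|^m = |ϖ|^{n₃}`, ★ `v_one_sub_glueUnit`) and `|κ + g₀| < 1` force `|1 + κ| < 1`, contradicting the unit letter `|xζ + y″| = |xζ|·|1 + κ| = 1`.
* §1 `mapGL_latt_coreHangingTwo_eq_iff_kappa` — stability on the foot in `κ`-currency.
* §2 `coreHangingTwoStratum_eq_empty_of_ne`, `…_of_lt`, `…_of_ne₃` — the empty regimes.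
HONEST LABEL.  Count-neutral; the census laws stay PROVER TARGETS until the MS assembly lands; `HC_CM` is proved only modulo the 7 printed citations (2 remaining named inputs:
hLiu418 = `stmt-HodgeConjecture-24832`, h413 = `stmt-HodgeConjecture-24833`) until rung 0 closes.

## References
* [Kottwitz1986BaseChangeUnits] R. Kottwitz, *Base change for unit elements of Hecke algebras*, Compositio Math. 60 (1986), §1 pp. 240–241 (lattice counts via torus orbits).
* [Rogawski1990] J. D. Rogawski, *Automorphic Representations of Unitary Groups in Three Variables*, Ann. of Math. Stud. 123 (1990), §4.9 Prop. 4.9.1 (a) p. 55.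
* [Serre1980Trees] J.-P. Serre, *Trees*, Springer (1980), Ch. II §1.1 (lattices `g·𝒪^N`, Hermite normal forms).
-/

set_option autoImplicit false

noncomputable section

namespace Summit.HodgeConjecture.HodgeConjecture.Cruxes.H413.F0P3cDyRamDiagonalCoreHangingFootTypeTwo

open Matrix WithZero
open Literature.NumberTheory.Automorphic Literature.NumberTheory.Automorphic.HermitianLattice
open Literature.NumberTheory.Automorphic.UnitaryLatticeTree
open Literature.NumberTheory.LocalFields.WildQuadraticDatum
open Summit.HodgeConjecture.HodgeConjecture.Cruxes.H413.F0P3cDyRamDiagonalTorusDefs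
open Summit.HodgeConjecture.HodgeConjecture.Cruxes.H413.F0P3cDyRamDiagonalStrataDefs
open Summit.HodgeConjecture.HodgeConjecture.Cruxes.H413.F0P3cDyRamDiagonalGluedTorusOrbits
open Summit.HodgeConjecture.HodgeConjecture.Cruxes.H413.F0P3cDyRamDiagonalCoreHangingOrbits
open Summit.HodgeConjecture.HodgeConjecture.Cruxes.H413.F0P3cDyRamDiagonalCoreHangingFoot
open Summit.HodgeConjecture.HodgeConjecture.Cruxes.H413.F0P3cDyRamDiagonalGluedStabiliserIndex
open Summit.HodgeConjecture.HodgeConjecture.Cruxes.H413.F0P3cDyRamDiagonalGluedStabilityCorner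
open scoped Valued WithZero Matrix MatrixGroups

variable {K : Type*} [Field K] [Valued K ℤᵐ⁰]

/-! ## §1 Stability at the corner `2ρ+1` in `κ`-currency on the foot `n₁ = n₂ = m` -/

/-- **STABILITY OF A CORE-HANGING TYPE-2 LATTICE ON THE FOOT `|β−1| = |α−1| = |ϖ|^m`**: `T·latt V_H₂(x,ζ,y″) = latt V_H₂ ⟺ ρ ≤ n₃ ∧ ρ + 1 ≤ m ∧ |κ + g₀| ≤ |ϖ|^{2ρ+1−m}` with
`κ = y″∕(xζ)`, `g₀ = (β−1)∕(α−1)` (★ `mapGL_latt_hnf_glued_corner_eq_iff` at `s = 0`, `e = 1`; `(β−1)xζ + (α−1)y″ = (α−1)·xζ·(g₀ + κ)`; for `2ρ+1 ≤ m` the last clause is vacuous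
on both sides — ℕ-subtraction exact). [cite: Kottwitz1986BaseChangeUnits, §1 pp. 240–241] [cite: Rogawski1990, §4.9 Prop. 4.9.1 (a) p. 55] -/
theorem mapGL_latt_coreHangingTwo_eq_iff_kappa {ϖ : K} (hϖ : Valued.v ϖ = exp (-1 : ℤ)) {α β : K} (hα : Valued.v α = 1) (hβ : Valued.v β = 1)
    (T : GL (Fin 3) K) (hT : (T : Matrix (Fin 3) (Fin 3) K) = Matrix.diagonal ![α, β, 1]) {m n₃ : ℕ}
    (h₁ : Valued.v (β - 1) = Valued.v ϖ ^ m) (h₂ : Valued.v (α - 1) = Valued.v ϖ ^ m) (h₃ : Valued.v (β - α) = Valued.v ϖ ^ n₃)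
    (ρ : ℕ) {x ζ y'' : K} (hx : Valued.v x = 1) (hζ : Valued.v ζ = 1) (hy'' : Valued.v y'' = 1) (V : GL (Fin 3) K)
    (hV : (V : Matrix (Fin 3) (Fin 3) K) = !![1, 0, 0; x, ϖ ^ ρ, 0; x * ζ + y'', ϖ ^ ρ * ζ, ϖ ^ (2 * ρ + 1)]) :
    mapGL T (latt (V : Matrix (Fin 3) (Fin 3) K)) = latt (V : Matrix (Fin 3) (Fin 3) K) ↔
      ρ ≤ n₃ ∧ ρ + 1 ≤ m ∧ Valued.v (y'' / (x * ζ) + (β - 1) / (α - 1)) ≤ Valued.v ϖ ^ (2 * ρ + 1 - m) := by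
  obtain ⟨hϖ0, hϖ1⟩ := ne_zero_and_v_lt_one_of_v_eq_exp hϖ
  have hvϖ : 0 < Valued.v ϖ := (Valuation.pos_iff _).2 hϖ0
  have hV0 : (V : Matrix (Fin 3) (Fin 3) K) = !![1, 0, 0; x, ϖ ^ ρ, 0; x * ζ + y'', ϖ ^ ρ * ζ, ϖ ^ (2 * ρ + 0 + 1)] := by rw [Nat.add_zero]; exact hV
  rw [mapGL_latt_hnf_glued_corner_eq_iff hϖ0 hα hβ T hT ρ 0 1 x ζ y'' V hV0, Nat.add_zero, Nat.add_zero]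
  have hx0 : x ≠ 0 := fun h0 => by rw [h0, map_zero] at hx; exact zero_ne_one hx
  have hζ0 : ζ ≠ 0 := fun h0 => by rw [h0, map_zero] at hζ; exact zero_ne_one hζ
  have hα1 : α - 1 ≠ 0 := fun h0 => by rw [h0, map_zero] at h₂; exact pow_ne_zero _ hvϖ.ne' h₂.symm
  have hle : ∀ {a b : ℕ}, Valued.v ϖ ^ a ≤ Valued.v ϖ ^ b ↔ b ≤ a := fun {a b} => by
    rw [v_varpi_pow hϖ, v_varpi_pow hϖ, exp_le_exp]; omega
  -- (S2) and (S1)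
  have e2 : Valued.v ((β - α) * x) ≤ Valued.v ϖ ^ ρ ↔ ρ ≤ n₃ := by rw [map_mul, hx, mul_one, h₃, hle]
  have e1 : Valued.v ((β - 1) * ζ) ≤ Valued.v ϖ ^ (ρ + 1) ↔ ρ + 1 ≤ m := by rw [map_mul, hζ, mul_one, h₁, hle]
  -- (S3): `(β−1)xζ + (α−1)y″ = (α−1)·(xζ)·(g₀ + κ)`
  have e3' : (β - 1) * x * ζ + (α - 1) * y'' = (α - 1) * (x * ζ) * (y'' / (x * ζ) + (β - 1) / (α - 1)) := by
    field_simp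
    ring
  have e3 : Valued.v ((β - 1) * x * ζ + (α - 1) * y'') ≤ Valued.v ϖ ^ (2 * ρ + 1) ↔
      Valued.v (y'' / (x * ζ) + (β - 1) / (α - 1)) ≤ Valued.v ϖ ^ (2 * ρ + 1 - m) := by
    rw [e3', map_mul, map_mul, map_mul, h₂, hx, hζ, mul_one, mul_one]
    rcases le_or_gt m (2 * ρ + 1) with hm | hm
    · rw [show 2 * ρ + 1 = m + (2 * ρ + 1 - m) by omega, pow_add, show m + (2 * ρ + 1 - m) - m = 2 * ρ + 1 - m by omega]
      exact mul_le_mul_iff_of_pos_left (pow_pos hvϖ _)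
    · -- both sides hold: `|κ + g₀| ≤ 1`
      have hκg : Valued.v (y'' / (x * ζ) + (β - 1) / (α - 1)) ≤ 1 := by
        refine Valuation.map_add_le _ ?_ ?_
        · rw [map_div₀, map_mul, hx, hζ, mul_one, hy'', div_one]
        · rw [map_div₀, h₁, h₂, div_self (pow_ne_zero _ hvϖ.ne')]
      rw [show 2 * ρ + 1 - m = 0 by omega, pow_zero]
      refine ⟨fun _ => hκg, fun _ => ?_⟩
      calc Valued.v ϖ ^ m * Valued.v (y'' / (x * ζ) + (β - 1) / (α - 1)) ≤ Valued.v ϖ ^ m * 1 := mul_le_mul_right hκg _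
        _ = Valued.v ϖ ^ m := mul_one _
        _ ≤ Valued.v ϖ ^ (2 * ρ + 1) := hle.2 hm.le
  rw [e2, e1, e3]

/-! ## §2 The EMPTY regimes -/

/-- **BELOW THE TUBE, OFF THE FOOT, THE STRATUM IS EMPTY**: `n₁ ≠ n₂` and `¬(2ρ+1 ≤ n₁ ∧ 2ρ+1 ≤ n₂)` ⇒ no core-hanging type-2 lattice is `T`-stable (★
`depths_of_mapGL_latt_hnf_glued_typeTwo_eq` at `s = 0`). [cite: Kottwitz1986BaseChangeUnits, §1 pp. 240–241] -/
theorem coreHangingTwoStratum_eq_empty_of_ne (σ : K →+* K) {ϖ : K} (hϖ : Valued.v ϖ = exp (-1 : ℤ))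
    (T : GL (Fin 3) K) {α β : K} (hT : (T : Matrix (Fin 3) (Fin 3) K) = Matrix.diagonal ![α, β, 1]) (hα : Valued.v α = 1) (hβ : Valued.v β = 1)
    {n₁ n₂ : ℕ} (h₁ : Valued.v (β - 1) = Valued.v ϖ ^ n₁) (h₂ : Valued.v (α - 1) = Valued.v ϖ ^ n₂) (hne : n₁ ≠ n₂)
    {ρ : ℕ} (hlow : ¬ (2 * ρ + 1 ≤ n₁ ∧ 2 * ρ + 1 ≤ n₂)) :
    {M : Submodule 𝒪[K] (Fin 3 → K) | M ∈ normalisedStableLattices T ∧ IsTypeTwoPolarisable σ ϖ M ∧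
        ∃ x ζ y'' : K, Valued.v x = 1 ∧ Valued.v ζ = 1 ∧ Valued.v y'' = 1 ∧ Valued.v (x * ζ + y'') = 1 ∧
          M = latt (!![1, 0, 0; x, ϖ ^ ρ, 0; x * ζ + y'', ϖ ^ ρ * ζ, ϖ ^ (2 * ρ + 1)] : Matrix (Fin 3) (Fin 3) K)} = ∅ := by
  obtain ⟨hϖ0, hϖ1⟩ := ne_zero_and_v_lt_one_of_v_eq_exp hϖ
  refine Set.eq_empty_of_forall_notMem fun M ⟨⟨_, hTM, _⟩, _, x, ζ, y'', hx, hζ, hy'', _, hM⟩ => ?_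
  obtain ⟨V, hV⟩ := exists_gl_coe_eq_glued x ζ y'' (pow_ne_zero ρ hϖ0) (pow_ne_zero (2 * ρ + 1) hϖ0)
  have hV0 : (V : Matrix (Fin 3) (Fin 3) K) = !![1, 0, 0; x, ϖ ^ ρ, 0; x * ζ + y'', ϖ ^ ρ * ζ, ϖ ^ (2 * ρ + 1 + 0)] := by rw [Nat.add_zero]; exact hV
  rw [hM, ← hV] at hTM
  have h := depths_of_mapGL_latt_hnf_glued_typeTwo_eq hϖ0 hϖ1 hα hβ T hT h₁ h₂ ρ 0 (by rwa [Nat.add_zero]) hx hζ (by rw [pow_zero]; exact hy'') V hV0 hTM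
  exact hlow ⟨by omega, h.2⟩

/-- **ON THE FOOT BELOW HEIGHT `ρ + 1` THE STRATUM IS EMPTY**: `n₁ = n₂ = m < ρ + 1` ⇒ (S1) fails. [cite: Kottwitz1986BaseChangeUnits, §1 pp. 240–241] -/
theorem coreHangingTwoStratum_eq_empty_of_lt (σ : K →+* K) {ϖ : K} (hϖ : Valued.v ϖ = exp (-1 : ℤ))
    (T : GL (Fin 3) K) {α β : K} (hT : (T : Matrix (Fin 3) (Fin 3) K) = Matrix.diagonal ![α, β, 1]) (hα : Valued.v α = 1) (hβ : Valued.v β = 1)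
    {m n₃ : ℕ} (h₁ : Valued.v (β - 1) = Valued.v ϖ ^ m) (h₂ : Valued.v (α - 1) = Valued.v ϖ ^ m) (h₃ : Valued.v (β - α) = Valued.v ϖ ^ n₃)
    {ρ : ℕ} (hlow : m < ρ + 1) :
    {M : Submodule 𝒪[K] (Fin 3 → K) | M ∈ normalisedStableLattices T ∧ IsTypeTwoPolarisable σ ϖ M ∧
        ∃ x ζ y'' : K, Valued.v x = 1 ∧ Valued.v ζ = 1 ∧ Valued.v y'' = 1 ∧ Valued.v (x * ζ + y'') = 1 ∧
          M = latt (!![1, 0, 0; x, ϖ ^ ρ, 0; x * ζ + y'', ϖ ^ ρ * ζ, ϖ ^ (2 * ρ + 1)] : Matrix (Fin 3) (Fin 3) K)} = ∅ := by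
  obtain ⟨hϖ0, -⟩ := ne_zero_and_v_lt_one_of_v_eq_exp hϖ
  refine Set.eq_empty_of_forall_notMem fun M ⟨⟨_, hTM, _⟩, _, x, ζ, y'', hx, hζ, hy'', _, hM⟩ => ?_
  obtain ⟨V, hV⟩ := exists_gl_coe_eq_glued x ζ y'' (pow_ne_zero ρ hϖ0) (pow_ne_zero (2 * ρ + 1) hϖ0)
  rw [hM, ← hV] at hTM
  obtain ⟨-, hρm, -⟩ := (mapGL_latt_coreHangingTwo_eq_iff_kappa hϖ hα hβ T hT h₁ h₂ h₃ ρ hx hζ hy'' V hV).1 hTM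
  omega

/-- **ON THE FOOT, BELOW THE TUBE, OFF THE EQUILATERAL CASE THE STRATUM IS EMPTY**: `n₁ = n₂ = m < 2ρ+1`, `n₃ ≠ m` ⇒ stability forces `κ ≡ −g₀ (𝔭)` while `|1 − g₀| < 1`,
so `|1 + κ| < 1`, contradicting the unit letter `|xζ + y″| = 1`. [cite: Kottwitz1986BaseChangeUnits, §1 pp. 240–241] [cite: Rogawski1990, §4.9 Prop. 4.9.1 (a) p. 55] -/
theorem coreHangingTwoStratum_eq_empty_of_ne₃ (σ : K →+* K) {ϖ : K} (hϖ : Valued.v ϖ = exp (-1 : ℤ))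
    (T : GL (Fin 3) K) {α β : K} (hT : (T : Matrix (Fin 3) (Fin 3) K) = Matrix.diagonal ![α, β, 1]) (hα : Valued.v α = 1) (hβ : Valued.v β = 1)
    {m n₃ : ℕ} (h₁ : Valued.v (β - 1) = Valued.v ϖ ^ m) (h₂ : Valued.v (α - 1) = Valued.v ϖ ^ m) (h₃ : Valued.v (β - α) = Valued.v ϖ ^ n₃)
    {ρ : ℕ} (hm : m < 2 * ρ + 1) (hn₃ : n₃ ≠ m) :
    {M : Submodule 𝒪[K] (Fin 3 → K) | M ∈ normalisedStableLattices T ∧ IsTypeTwoPolarisable σ ϖ M ∧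
        ∃ x ζ y'' : K, Valued.v x = 1 ∧ Valued.v ζ = 1 ∧ Valued.v y'' = 1 ∧ Valued.v (x * ζ + y'') = 1 ∧
          M = latt (!![1, 0, 0; x, ϖ ^ ρ, 0; x * ζ + y'', ϖ ^ ρ * ζ, ϖ ^ (2 * ρ + 1)] : Matrix (Fin 3) (Fin 3) K)} = ∅ := by
  obtain ⟨hϖ0, hϖ1⟩ := ne_zero_and_v_lt_one_of_v_eq_exp hϖ
  have hvϖ : 0 < Valued.v ϖ := (Valuation.pos_iff _).2 hϖ0
  refine Set.eq_empty_of_forall_notMem fun M ⟨⟨_, hTM, _⟩, _, x, ζ, y'', hx, hζ, hy'', hy, hM⟩ => ?_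
  obtain ⟨V, hV⟩ := exists_gl_coe_eq_glued x ζ y'' (pow_ne_zero ρ hϖ0) (pow_ne_zero (2 * ρ + 1) hϖ0)
  rw [hM, ← hV] at hTM
  obtain ⟨-, -, hS3⟩ := (mapGL_latt_coreHangingTwo_eq_iff_kappa hϖ hα hβ T hT h₁ h₂ h₃ ρ hx hζ hy'' V hV).1 hTM
  -- `|κ + g₀| < 1` and `|1 − g₀| < 1`, so `|1 + κ| < 1`
  have hκg : Valued.v (y'' / (x * ζ) + (β - 1) / (α - 1)) < 1 :=
    hS3.trans_lt (pow_lt_one₀ zero_le hϖ1 (by omega))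
  have h1g : Valued.v (1 - (β - 1) / (α - 1)) < 1 := by
    have h := v_one_sub_glueUnit hϖ h₂ h₃
    by_contra hge
    rw [not_lt] at hge
    have hle1 : Valued.v (1 - (β - 1) / (α - 1)) ≤ 1 := by
      refine Valuation.map_sub_le _ (by rw [map_one]) ?_
      rw [map_div₀, h₁, h₂, div_self (pow_ne_zero _ hvϖ.ne')]
    have heq : Valued.v (1 - (β - 1) / (α - 1)) = 1 := le_antisymm hle1 hge
    rw [heq, one_mul] at h
    exact hn₃ (pow_right_injective₀ hvϖ hϖ1.ne h).symm
  have h1κ : Valued.v (1 + y'' / (x * ζ)) < 1 := by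
    rw [show 1 + y'' / (x * ζ) = (1 - (β - 1) / (α - 1)) + (y'' / (x * ζ) + (β - 1) / (α - 1)) by ring]
    exact (Valuation.map_add _ _ _).trans_lt (max_lt h1g hκg)
  exact absurd (v_one_add_kappa_eq_one hx hζ hy) h1κ.ne

end Summit.HodgeConjecture.HodgeConjecture.Cruxes.H413.F0P3cDyRamDiagonalCoreHangingFootTypeTwo

end
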